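import Mathlib
import Summits.CriticalPhenomena.Ising3DConformalLimit.Theorems.MarkovRigidityFieldRealisationCells
import Summits.CriticalPhenomena.Ising3DConformalLimit.Theorems.MarkovRigidityFieldRealisationDominator
import Summits.CriticalPhenomena.Ising3DConformalLimit.Theorems.HyperoctahedralRPTwoPointKernelOfLimitClauses
import HarnessLib

/-!
# Route MarkovRigidity, support item `FieldRealisation` (stmt-CriticalPhenomena-11245):
# convergence of the smeared critical correlators to the smeared scaling limit

Fourth helper towards clause (b) of `FieldRealisation`: the **smeared `n`-point sums converge**,
`Σ_{z ∈ Λ_δⁿ} (∏ᵢ ρ(δ) δ³ gᵢ(δzᵢ)) ⟨∏ᵢ σ_{zᵢ}⟩_{β_c} → ∫_{(ℝ³)ⁿ} (∏ᵢ gᵢ(xᵢ)) Sₙ(x) dx` as `δ → 0⁺`,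
for boxes `Λ_δ = box 3 (L δ)` with `δ L(δ) → ∞` and continuous weights `gᵢ` with
`|gᵢ(p)| ≤ B (1+‖p‖)^{-N}`, `N > 3`, whenever `S` is a pointwise scaling limit of `criticalCorr 3`
under `ρ` which is non-degenerate and scale covariant with `0 < Δ < 3/2`
(`tendsto_smearedSum`).  Dominated convergence on `(ℝ³)ⁿ` along `𝓝[>] 0`: the sums are integrals of
step functions (`smearedSum_eq_integral`), which converge at every non-coincident configuration
(the lattice points `δ⌊x/δ⌋` tend to `x`, the boxes exhaust `ℝ³`, and the rescaled correlator tends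
to `Sₙ(x)`), the coincident configurations are Lebesgue-null, odd correlators vanish, and the even
ones are dominated uniformly in the mesh by the integrable Gaussian-pairing dominator
(`rescaledCorrelator_le_pairingSum_kernel`, `integrable_weight_mul_pairingSum`).

References: Glimm–Jaffe 1987 §6.1; Aizenman–Duminil-Copin 2021 §6.3.  No definitions.
-/

noncomputable section

namespace Summit.CriticalPhenomena.Ising3DConformalLimit.MarkovRigidityFieldRealisation

open MeasureTheory Filter Literature.Probability.LatticeModels Literature.MathematicalPhysics.QuantumLattice
open Summit.CriticalPhenomena.Ising3DConformalLimit
open scoped ENNReal Topology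

/-! ### Coincident configurations are null -/

/-- The coincident configurations of `(ℝ³)ⁿ` form a Lebesgue-null set (a finite union of proper
linear subspaces `{xᵢ = xⱼ}`). [folklore] -/
theorem volume_compl_nonCoincident (n : ℕ) : volume (NonCoincident 3 n)ᶜ = 0 := by
  have hsub : (NonCoincident 3 n)ᶜ ⊆ ⋃ p : {p : Fin n × Fin n // p.1 ≠ p.2},
      {x : Fin n → (EuclideanSpace ℝ (Fin 3)) | x p.1.1 = x p.1.2} := by
    intro x hx
    simp only [Set.mem_compl_iff, mem_nonCoincident, Function.Injective, not_forall] at hx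
    obtain ⟨i, j, hij, hne⟩ := hx
    exact Set.mem_iUnion.2 ⟨⟨(i, j), hne⟩, hij⟩
  refine measure_mono_null hsub ((measure_iUnion_null_iff).2 fun p => ?_)
  -- `{x | x i = x j}` is a proper submodule
  set V : Submodule ℝ (Fin n → (EuclideanSpace ℝ (Fin 3))) := LinearMap.ker
    ((LinearMap.proj p.1.1 : (Fin n → (EuclideanSpace ℝ (Fin 3))) →ₗ[ℝ] (EuclideanSpace ℝ (Fin 3))) - LinearMap.proj p.1.2) with hV
  have hVset : {x : Fin n → (EuclideanSpace ℝ (Fin 3)) | x p.1.1 = x p.1.2} = (V : Set (Fin n → (EuclideanSpace ℝ (Fin 3)))) := by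
    ext x; simp [hV, sub_eq_zero]
  have hVtop : V ≠ ⊤ := by
    intro htop
    obtain ⟨v, hv⟩ : ∃ v : (EuclideanSpace ℝ (Fin 3)), v ≠ 0 := ⟨EuclideanSpace.single 0 1, by simp⟩
    have hmem : (Pi.single p.1.1 v : Fin n → (EuclideanSpace ℝ (Fin 3))) ∈ V := by rw [htop]; trivial
    rw [hV, LinearMap.mem_ker] at hmem
    simp only [LinearMap.sub_apply, LinearMap.coe_proj, Function.eval, Pi.single_eq_same,
      Pi.single_eq_of_ne p.2.symm, sub_zero] at hmem
    exact hv hmem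
  rw [hVset]
  exact Measure.addHaar_submodule volume V hVtop

/-- Almost every configuration is non-coincident. [folklore] -/
theorem ae_mem_nonCoincident (n : ℕ) : ∀ᵐ x : Fin n → (EuclideanSpace ℝ (Fin 3)), x ∈ NonCoincident 3 n :=
  mem_ae_iff.mpr (volume_compl_nonCoincident n)

/-! ### Pointwise behaviour of the step functions -/

/-- The lattice point below `p` at mesh `δ` is within `2δ` of `p`. [folklore] -/
theorem norm_smul_siteToE_latticeApprox_sub_le {δ : ℝ} (hδ : 0 < δ) (p : (EuclideanSpace ℝ (Fin 3))) :
    ‖δ • siteToE (latticeApprox δ p) - p‖ ≤ 2 * δ := by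
  refine MoebiusLimitExistsNegative.norm_le_two_mul_of_abs_le fun k => ?_
  have h1 := Int.floor_le (p k / δ)
  have h2 := Int.lt_floor_add_one (p k / δ)
  rw [le_div_iff₀ hδ] at h1
  rw [div_lt_iff₀ hδ] at h2
  have : (δ • siteToE (latticeApprox δ p) - p) k = δ * ⌊p k / δ⌋ - p k := by
    simp [latticeApprox_apply, siteToE]
  rw [this, abs_le]
  constructor <;> nlinarith

/-- The lattice points below `p` tend to `p` as the mesh tends to `0⁺`. [folklore] -/
theorem tendsto_smul_siteToE_latticeApprox (p : (EuclideanSpace ℝ (Fin 3))) :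
    Tendsto (fun δ : ℝ => δ • siteToE (latticeApprox δ p)) (𝓝[>] 0) (𝓝 p) :=
  HyperoctahedralRPTwoPoint.tendsto_smul_siteVec_latticeApprox p

/-- Eventually every lattice point below a fixed configuration lies in the box `box 3 (L δ)`
when `δ L(δ) → ∞`. [folklore] -/
theorem eventually_latticeApprox_mem_box {L : ℝ → ℕ}
    (hL : Tendsto (fun δ => δ * L δ) (𝓝[>] 0) atTop) {n : ℕ} (x : Fin n → (EuclideanSpace ℝ (Fin 3))) :
    ∀ᶠ δ in 𝓝[>] (0 : ℝ), ∀ i, latticeApprox δ (x i) ∈ box 3 (L δ) := by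
  set M : ℝ := ∑ i, ∑ k, |x i k| with hM
  have hcoord : ∀ i k, |x i k| ≤ M := fun i k => by
    rw [hM]
    exact (Finset.single_le_sum (f := fun k => |x i k|) (fun _ _ => abs_nonneg _)
      (Finset.mem_univ k)).trans
      (Finset.single_le_sum (f := fun i => ∑ k, |x i k|)
        (fun _ _ => Finset.sum_nonneg fun _ _ => abs_nonneg _) (Finset.mem_univ i))
  have h1 : ∀ᶠ δ in 𝓝[>] (0 : ℝ), M + 1 ≤ δ * L δ := hL.eventually_ge_atTop _
  have h2 : ∀ᶠ δ in 𝓝[>] (0 : ℝ), δ < 1 :=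
    (eventually_lt_nhds zero_lt_one).filter_mono nhdsWithin_le_nhds
  have h3 : ∀ᶠ δ in 𝓝[>] (0 : ℝ), 0 < δ := eventually_mem_nhdsWithin
  filter_upwards [h1, h2, h3] with δ hδL hδ1 hδ i
  rw [mem_box]
  intro k
  rw [latticeApprox_apply]
  have hx := hcoord i k
  rw [abs_le] at hx
  have hlo : -(L δ : ℝ) ≤ x i k / δ - 1 := by
    rw [le_sub_iff_add_le, le_div_iff₀ hδ]; nlinarith
  have hhi : x i k / δ < L δ := by
    rw [div_lt_iff₀ hδ]; nlinarith
  constructor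
  · have := Int.lt_floor_add_one (x i k / δ)
    have h : (-(L δ : ℤ) : ℝ) < (⌊x i k / δ⌋ : ℝ) + 1 := by push_cast; linarith
    have h' : (-(L δ : ℤ) : ℤ) < ⌊x i k / δ⌋ + 1 := by exact_mod_cast h
    omega
  · have := Int.floor_le (x i k / δ)
    have h : (⌊x i k / δ⌋ : ℝ) < (L δ : ℤ) := by push_cast; linarith
    exact_mod_cast h.le

/-- Comparison of the weights at nearby points: if `‖p' − p‖ ≤ 2` then
`(1+‖p'‖)^{-N} ≤ 3^N (1+‖p‖)^{-N}` (`N ≥ 0`). [folklore] -/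
theorem weight_le_of_norm_sub_le {N : ℝ} (hN : 0 ≤ N) {p p' : (EuclideanSpace ℝ (Fin 3))} (h : ‖p' - p‖ ≤ 2) :
    (1 + ‖p'‖) ^ (-N) ≤ (3 : ℝ) ^ N * (1 + ‖p‖) ^ (-N) := by
  have hle : (1 + ‖p‖) / 3 ≤ 1 + ‖p'‖ := by
    rw [div_le_iff₀ (by norm_num)]
    have h' : ‖p‖ ≤ ‖p'‖ + ‖p' - p‖ := by
      calc ‖p‖ = ‖p' - (p' - p)‖ := by rw [sub_sub_cancel]
        _ ≤ ‖p'‖ + ‖p' - p‖ := norm_sub_le _ _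
    nlinarith [norm_nonneg p']
  calc (1 + ‖p'‖) ^ (-N) ≤ ((1 + ‖p‖) / 3) ^ (-N) :=
        Real.rpow_le_rpow_of_nonpos (by positivity) hle (by linarith)
    _ = (3 : ℝ) ^ N * (1 + ‖p‖) ^ (-N) := by
        rw [Real.div_rpow (by positivity) (by norm_num), Real.rpow_neg (by norm_num : (0:ℝ) ≤ 3),
          div_eq_mul_inv, inv_inv, mul_comm]

/-- The Wick pairing functional of a nonnegative kernel is nonnegative. [folklore] -/
theorem pairingSum_nonneg {α : Type*} {K : α → α → ℝ} (hK : ∀ p q, 0 ≤ K p q) (m : ℕ)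
    (x : Fin (2 * m) → α) : 0 ≤ pairingSum K m x := by
  unfold pairingSum
  exact mul_nonneg (by positivity) (Finset.sum_nonneg fun τ _ => Finset.prod_nonneg fun j _ => hK _ _)

/-- The step functions are measurable (they factor through the countable space of lattice
configurations). [folklore] -/
theorem measurable_stepFunction (ρ : ℝ → ℝ) (δ : ℝ) {n : ℕ} (Λ : Finset (Site 3))
    (g : Fin n → (EuclideanSpace ℝ (Fin 3)) → ℝ) :
    Measurable fun x : Fin n → (EuclideanSpace ℝ (Fin 3)) => if (∀ i, latticeApprox δ (x i) ∈ Λ) then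
      (∏ i, g i (δ • siteToE (latticeApprox δ (x i)))) *
        rescaledCorrelator (criticalCorr 3) ρ n δ x else 0 := by
  classical
  have hF : (fun x : Fin n → (EuclideanSpace ℝ (Fin 3)) => if (∀ i, latticeApprox δ (x i) ∈ Λ) then
      (∏ i, g i (δ • siteToE (latticeApprox δ (x i)))) *
        rescaledCorrelator (criticalCorr 3) ρ n δ x else 0) =
      (fun z : Fin n → Site 3 => if (∀ i, z i ∈ Λ) then
        (∏ i, g i (δ • siteToE (z i))) * (ρ δ ^ n * criticalCorr 3 n z) else 0) ∘
      fun x i => latticeApprox δ (x i) := by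
    funext x; simp only [Function.comp_apply, rescaledCorrelator_apply]
  rw [hF]
  exact (measurable_of_countable _).comp (measurable_cfg n δ)

/-- **Convergence of the smeared critical correlators.**  Let `S` be a pointwise scaling limit of
`criticalCorr 3` under `ρ`, non-degenerate and scale covariant with `0 < Δ < 3/2`; let `L(δ)` be box
sides with `δ L(δ) → ∞`, and `gᵢ` continuous weights with `|gᵢ(p)| ≤ B (1+‖p‖)^{-N}`, `N > 3`.
Then `Σ_{z ∈ (box 3 (L δ))ⁿ} (∏ᵢ ρ(δ) δ³ gᵢ(δzᵢ)) ⟨∏ᵢ σ_{zᵢ}⟩_{β_c} → ∫ (∏ᵢ gᵢ(xᵢ)) Sₙ(x) dx` as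
`δ → 0⁺`. [cite: GlimmJaffe1987, §6.1] -/
theorem tendsto_smearedSum {ρ : ℝ → ℝ} {Δ : ℝ} {S : CorrFamily 3}
    (hlim : HasPointwiseScalingLimit (criticalCorr 3) ρ S) (hnd : IsNondegenerateTwoPoint S)
    (hsc : IsScaleCovariant Δ S) (hΔ0 : 0 < Δ) (hΔ : Δ < 3 / 2)
    {L : ℝ → ℕ} (hL : Tendsto (fun δ => δ * L δ) (𝓝[>] 0) atTop)
    {n : ℕ} (g : Fin n → (EuclideanSpace ℝ (Fin 3)) → ℝ) (hgc : ∀ i, Continuous (g i)) {B N : ℝ} (hN : 3 < N)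
    (hgB : ∀ i p, |g i p| ≤ B * (1 + ‖p‖) ^ (-N)) :
    Tendsto (fun δ => ∑ z ∈ Fintype.piFinset (fun _ : Fin n => box 3 (L δ)),
        (∏ i, ρ δ * δ ^ 3 * g i (δ • siteToE (z i))) * criticalCorr 3 n z)
      (𝓝[>] 0) (𝓝 (∫ x : Fin n → (EuclideanSpace ℝ (Fin 3)), (∏ i, g i (x i)) * S n x)) := by
  obtain ⟨a, C, δ₀, ha2, ha3, hC, hδ₀, hK⟩ := rho_sq_mul_criticalTwoPoint_le hlim hnd hsc hΔ0 hΔ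
  have ha0 : 0 ≤ a := by linarith
  -- the step functions
  set F : ℝ → (Fin n → (EuclideanSpace ℝ (Fin 3))) → ℝ := fun δ x => if (∀ i, latticeApprox δ (x i) ∈ box 3 (L δ)) then
    (∏ i, g i (δ • siteToE (latticeApprox δ (x i)))) *
      rescaledCorrelator (criticalCorr 3) ρ n δ x else 0 with hFdef
  have hpos : ∀ᶠ δ in 𝓝[>] (0 : ℝ), 0 < δ := eventually_mem_nhdsWithin
  have heq : ∀ᶠ δ in 𝓝[>] (0 : ℝ), ∫ x, F δ x =
      ∑ z ∈ Fintype.piFinset (fun _ : Fin n => box 3 (L δ)),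
        (∏ i, ρ δ * δ ^ 3 * g i (δ • siteToE (z i))) * criticalCorr 3 n z := by
    filter_upwards [hpos] with δ hδ
    rw [smearedSum_eq_integral ρ hδ]
  refine Tendsto.congr' heq ?_
  -- pointwise limit at non-coincident configurations
  have hptw : ∀ x ∈ NonCoincident 3 n,
      Tendsto (fun δ => F δ x) (𝓝[>] 0) (𝓝 ((∏ i, g i (x i)) * S n x)) := by
    intro x hx
    have h1 : Tendsto (fun δ : ℝ => (∏ i, g i (δ • siteToE (latticeApprox δ (x i)))) *
        rescaledCorrelator (criticalCorr 3) ρ n δ x) (𝓝[>] 0) (𝓝 ((∏ i, g i (x i)) * S n x)) :=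
      (tendsto_finsetProd _ fun i _ =>
        ((hgc i).tendsto _).comp (tendsto_smul_siteToE_latticeApprox (x i))).mul
        ((hlim n).tendsto_at hx)
    refine h1.congr' ?_
    filter_upwards [eventually_latticeApprox_mem_box hL x] with δ hδ
    rw [hFdef]; dsimp only; rw [if_pos hδ]
  have hlimae : ∀ᵐ x : Fin n → (EuclideanSpace ℝ (Fin 3)), Tendsto (fun δ => F δ x) (𝓝[>] 0)
      (𝓝 ((∏ i, g i (x i)) * S n x)) := by
    filter_upwards [ae_mem_nonCoincident n] with x hx using hptw x hx
  -- parity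
  rcases Nat.even_or_odd n with hev | hodd
  · obtain ⟨m, hm⟩ := hev
    rw [← two_mul] at hm
    subst hm
    -- a nonnegative decay constant
    set B' : ℝ := max B 0 with hB'
    have hB'0 : 0 ≤ B' := le_max_right _ _
    have hgB' : ∀ i p, |g i p| ≤ B' * (1 + ‖p‖) ^ (-N) := fun i p =>
      (hgB i p).trans (mul_le_mul_of_nonneg_right (le_max_left _ _) (weight_nonneg N p))
    set Kc : (EuclideanSpace ℝ (Fin 3)) → (EuclideanSpace ℝ (Fin 3)) → ℝ := fun p q => max 1 (‖p - q‖ ^ (-a)) with hKc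
    set bound : (Fin (2 * m) → (EuclideanSpace ℝ (Fin 3))) → ℝ := fun x =>
      ((B' * (3 : ℝ) ^ N) ^ (2 * m) * (C * (4 : ℝ) ^ a) ^ m) *
        ((∏ i, (1 + ‖x i‖) ^ (-N)) * pairingSum Kc m x) with hbound
    refine tendsto_integral_filter_of_dominated_convergence bound ?_ ?_ ?_ hlimae
    · exact Eventually.of_forall fun δ => (measurable_stepFunction ρ δ _ g).aestronglyMeasurable
    · filter_upwards [Ioo_mem_nhdsGT (lt_min hδ₀ one_pos)] with δ hδ
      obtain ⟨hδ0, hδlt⟩ := hδ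
      have hδδ₀ : δ < δ₀ := hδlt.trans_le (min_le_left _ _)
      have hδ1 : δ < 1 := hδlt.trans_le (min_le_right _ _)
      filter_upwards [ae_mem_nonCoincident (2 * m)] with x hx
      have hw0 : 0 ≤ ∏ i, (1 + ‖x i‖) ^ (-N) := Finset.prod_nonneg fun i _ => weight_nonneg N (x i)
      have hpS0 : 0 ≤ pairingSum Kc m x :=
        pairingSum_nonneg (fun p q => le_trans zero_le_one (le_max_left _ _)) m x
      have hbd0 : 0 ≤ bound x := by
        rw [hbound]; exact mul_nonneg (by positivity) (mul_nonneg hw0 hpS0)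
      rw [hFdef]; dsimp only
      split_ifs with hbox
      · obtain ⟨hr0, hrle⟩ := rescaledCorrelator_le_pairingSum_kernel ha0 hK hδ0 hδδ₀ hx
        rw [Real.norm_eq_abs, abs_mul, abs_of_nonneg hr0, Finset.abs_prod]
        have hgi : ∀ i, |g i (δ • siteToE (latticeApprox δ (x i)))| ≤
            (B' * 3 ^ N) * (1 + ‖x i‖) ^ (-N) := by
          intro i
          have hnear : ‖δ • siteToE (latticeApprox δ (x i)) - x i‖ ≤ 2 :=
            (norm_smul_siteToE_latticeApprox_sub_le hδ0 (x i)).trans (by linarith)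
          calc |g i (δ • siteToE (latticeApprox δ (x i)))|
              ≤ B' * (1 + ‖δ • siteToE (latticeApprox δ (x i))‖) ^ (-N) := hgB' i _
            _ ≤ B' * ((3 : ℝ) ^ N * (1 + ‖x i‖) ^ (-N)) :=
                mul_le_mul_of_nonneg_left (weight_le_of_norm_sub_le (by linarith) hnear) hB'0
            _ = (B' * 3 ^ N) * (1 + ‖x i‖) ^ (-N) := by ring
        have hprod : ∏ i, |g i (δ • siteToE (latticeApprox δ (x i)))| ≤
            ∏ i, ((B' * 3 ^ N) * (1 + ‖x i‖) ^ (-N)) :=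
          Finset.prod_le_prod (fun i _ => abs_nonneg _) fun i _ => hgi i
        rw [Finset.prod_mul_distrib, Finset.prod_const, Finset.card_univ, Fintype.card_fin] at hprod
        calc (∏ i, |g i (δ • siteToE (latticeApprox δ (x i)))|) *
              rescaledCorrelator (criticalCorr 3) ρ (2 * m) δ x
            ≤ ((B' * 3 ^ N) ^ (2 * m) * ∏ i, (1 + ‖x i‖) ^ (-N)) *
                ((C * 4 ^ a) ^ m * pairingSum Kc m x) :=
              mul_le_mul hprod hrle hr0 (by positivity)
          _ = bound x := by rw [hbound]; ring
      · simpa using hbd0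
    · have hint := (integrable_weight_mul_pairingSum ha0 ha3 hN m).const_mul
        ((B' * (3 : ℝ) ^ N) ^ (2 * m) * (C * (4 : ℝ) ^ a) ^ m)
      rw [hbound, volume_pi]
      exact hint
  · -- odd `n`: everything vanishes
    have hF0 : ∀ δ x, F δ x = 0 := by
      intro δ x
      rw [hFdef]; dsimp only
      rw [rescaledCorrelator_apply, criticalCorr_eq_zero_of_odd le_rfl hodd, mul_zero, mul_zero, ite_self]
    have hS0 : ∀ x ∈ NonCoincident 3 n, S n x = 0 := by
      intro x hx
      have h := (hlim n).tendsto_at hx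
      have h0 : Tendsto (fun δ : ℝ => rescaledCorrelator (criticalCorr 3) ρ n δ x) (𝓝[>] 0) (𝓝 0) := by
        simp_rw [rescaledCorrelator_apply, criticalCorr_eq_zero_of_odd le_rfl hodd, mul_zero]
        exact tendsto_const_nhds
      exact tendsto_nhds_unique h h0
    have hint : ∫ x : Fin n → (EuclideanSpace ℝ (Fin 3)), (∏ i, g i (x i)) * S n x = 0 := by
      refine integral_eq_zero_of_ae ?_
      filter_upwards [ae_mem_nonCoincident n] with x hx
      simp [hS0 x hx]
    rw [hint]
    simp_rw [hF0, integral_zero]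
    exact tendsto_const_nhds

end Summit.CriticalPhenomena.Ising3DConformalLimit.MarkovRigidityFieldRealisation

end
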